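/-
Copyright: the b2b-balaban cell (near-miss cell 7), T⁴-continuum CRUX team (coordinator ruling e34b3e0c item (2)),
seat t4-ne7b-formalise-leaf-05 (gen 26), after the NE7b crux refuter's rc-0 scratch (`scratch/HealSet.lean`,
`scratch/CountFibred.lean`, seat `t4-ne7b-refuter` gen 4). Released under the licence of the surrounding project.
-/
import Summits.QuantumFields.BalabanUV.T4Continuum.Spine.NE7b.HealingMapCount

/-!
# The Peierls healing map with SET-VALUED healing (the (R-top) cut) and the POSITION-FIBRED count (F20b)
# (route NE7b R-H; refuter's PRICING-NE7b v4 F19 (iii) ∕ F20b, v5 F22 «(R-top) confirmed as the cut of record»)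

Cell `pub-balaban`, sub-cell `t4`, spine estimate NE7b (node U5c), candidate route R-H «Peierls healing map»
(`t4/ROUTES-NE7b.md` v5). The kernel half of R-H in the tree (`…NE7b.HealingMap`, `…NE7b.HealingMapCount`, lineage
leaf-04) heals each bad term into ONE term (`heal : ι → ι`, injective on the sub-class of a pinned component) and
counts pinned components by birth scale with a CARDINALITY hypothesis. The refuter's PRICING-NE7b re-cut both:

* **(R-top)** (v4 F19 (iii), v5 F22 — «the cut of record»): at the top level `k` a bad history `H` (component `C̃`
  pending) is healed into the CLASS `𝒫(H)` of histories equal to `H` off `C̃` and carrying ANY level-`k` pass∕fail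
  pattern on `C̃`'s test cubes; positivity and the partition-of-unity identity give `value(H) ≤ q·Σ_{τ ∈ 𝒫(H)} value(τ)`
  with the classes pairwise DISJOINT across the bad histories of one pinned component — «kernel shape = the refuter's
  `Scratch.sum_le_mul_sum_of_healSet` (hypotheses `hdisj : (↑Bad).PairwiseDisjoint heal`,
  `hle : ∀ b ∈ Bad, a b ≤ q * ∑ τ ∈ heal b, a τ`)».
* **F20b** (v4; v5 §3‴ «outstanding cheap items: F20b fibred count (≈ 25 l.)»): the inhabitable replacement of
  `sum_le_twoRate_sum`'s cardinality hypothesis — birth POSITIONS are counted (`≤ vol·Λ^{K−j}` per birth scale), the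
  shapes ∕ genealogies at a fixed birth position are SUMMED inside the quotient hypothesis
  («`Scratch.sum_le_twoRate_sum_fibred`»).

The refuter files no proofs (seat rule); this module lands both scratch kernels (proofs essentially verbatim, credited
above) and threads them to NE7b's output shape exactly as the single-valued chain does:
* §1 **`sum_le_mul_sum_of_healSet`** (the tree's single-valued `HealingMap.sum_le_mul_sum_of_heal` is its singleton
  case — shown as an `example`, not restated); `sum_le_sum_mul_sum_of_healSets` (cover over pinned components, BY NAME through
  `T4WeightBudget.relWeight_le_sum_of_cover`).
* §2 **`HealingLawsSet`** — the hypothesis SHAPE of a set-valued healing witness for one run (`heal : ℕ → α → ι → Finset ι`,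
  images inside `T K`, pairwise disjoint on each `Badx K x`, `A ≤ q·Σ_{heal} A`); `HealingLawsSet.ofLaws` (every
  single-valued witness is a set-valued one); `HealingLawsSet.bad_le`; **`relWeightBound_of_healingSet`** and
  **`exists_relWeightBound_of_healingSet_majorant`** — the same ENDs as `relWeightBound_of_healing` ∕
  `exists_relWeightBound_of_healing_majorant` (`T4WeightBudget.RelWeightBound`, early steps emptied).
* §3 **`sum_le_twoRate_sum_fibred`**, `sum_le_twoRate_majorant_fibred` (the tree's `twoRate_majorant_le` BY NAME) and
  **`exists_relWeightBound_of_healingSet_countFibred`** — set-valued healing laws for two runs + per run: birth scales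
  `< j⋆(K)`, birth POSITIONS counted by `vol·Λ^{K−j}`, and per birth position the quotients SUM to `≤ σ^{K−j}` ⟹
  `∃ K₀, RelWeightBound …` with the explicit weight `vol·(Λσ∕(1−Λσ))·(Λσ)^{K−j⋆(K)}`.

HONEST FRAMING. [folklore] finite-sum bookkeeping; every analytic input of R-H (the (R-top) reading and its value-level
condition on M2-B's index, F22 (a); H3's quotient bound; the position count and the per-position shape sum, F20b) is a
DISPLAYED hypothesis; nothing of [Bałaban 1983–89] is asserted or cited; no `def … : Prop` fact (one hypothesis-shape
`structure … : Prop`, like `HealingLaws`), no `[cite:]`. BY-NAME EFFECT ON THE WALL (`WALL-NE7b-P1.md` §2): NONE. NE7b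
(`T4WeightBudget.RelWeightBound`) NOT PRINTED, NOT PROVED; spine PROVED 0∕9; rung (B)+1 on a FINITE torus T⁴ — NOT
infinite volume, NOT the mass gap, NOT Clay. HONEST DEPENDENCY: continuum YM on T⁴ ⇐ BetaPertH ∧ nine spine estimates
(0/9 proved); BetaPertH ⇐ (D1) ∧ (D4) ∧ CAP+tail; G-an2-4 gates asym, D1 and NE2/3/4. POLICY (ruling e34b3e0c):
crux-route work of item (2) under `Spine/NE7b/`, NOT a `T4Continuum/Support` leaf.
-/

set_option autoImplicit false

open Finset
open Literature.MathematicalPhysics.QuantumFieldTheory.Balaban1983to89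
open Literature.MathematicalPhysics.QuantumFieldTheory.Balaban1983to89.T4WeightBudget
open Summit.QuantumFields.BalabanUV.T4Continuum.NE7b.HealingMap
  (HealingLaws sum_le_mul_sum_of_heal exists_relWeightBound_of_healing_majorant)

namespace Summit.QuantumFields.BalabanUV.T4Continuum.NE7b.HealingMapClass

/-! ## §1 The SET-VALUED healing inequality ((R-top)'s kernel shape) -/

section Heal

variable {α β : Type*} [DecidableEq β]

/-- **THE SET-VALUED HEALING INEQUALITY** (refuter's `Scratch.sum_le_mul_sum_of_healSet`, PRICING-NE7b v4 F19 (iii) ∕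
v5 F22). Heal every bad term `b` into a finite SET `heal b ⊆ T` of terms, the images PAIRWISE DISJOINT across `Bad`,
with `a b ≤ q·Σ_{τ ∈ heal b} a τ`, `q ≥ 0`, and non-negative weights on `T`; then `Σ_{Bad} a ≤ q·Σ_T a` — no global
denominator. [folklore] -/
theorem sum_le_mul_sum_of_healSet (Bad T : Finset β) {a : β → ℝ} (heal : β → Finset β) {q : ℝ}
    (ha : ∀ b ∈ T, 0 ≤ a b) (hq : 0 ≤ q) (hmem : ∀ b ∈ Bad, heal b ⊆ T)
    (hdisj : (↑Bad : Set β).PairwiseDisjoint heal)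
    (hle : ∀ b ∈ Bad, a b ≤ q * ∑ τ ∈ heal b, a τ) :
    ∑ b ∈ Bad, a b ≤ q * ∑ b ∈ T, a b :=
  calc ∑ b ∈ Bad, a b ≤ ∑ b ∈ Bad, q * ∑ τ ∈ heal b, a τ := Finset.sum_le_sum hle
    _ = q * ∑ τ ∈ Bad.biUnion heal, a τ := by rw [Finset.sum_biUnion hdisj, Finset.mul_sum]
    _ ≤ q * ∑ b ∈ T, a b :=
        mul_le_mul_of_nonneg_left
          (Finset.sum_le_sum_of_subset_of_nonneg (Finset.biUnion_subset.mpr hmem) fun b hb _ => ha b hb) hq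

/-- The tree's single-valued healing inequality `HealingMap.sum_le_mul_sum_of_heal` (same hypotheses, same
conclusion — imported, not restated) IS the singleton case `heal b = {heal₀ b}` of `sum_le_mul_sum_of_healSet`
(injectivity = pairwise disjointness of singletons): -/
example (Bad T : Finset β) {a : β → ℝ} (heal₀ : β → β) {q : ℝ}
    (ha : ∀ b ∈ T, 0 ≤ a b) (hq : 0 ≤ q) (hmem : ∀ b ∈ Bad, heal₀ b ∈ T)
    (hinj : Set.InjOn heal₀ ↑Bad) (hle : ∀ b ∈ Bad, a b ≤ q * a (heal₀ b)) :
    ∑ b ∈ Bad, a b ≤ q * ∑ b ∈ T, a b := by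
  refine sum_le_mul_sum_of_healSet Bad T (fun b => {heal₀ b}) ha hq
    (fun b hb => Finset.singleton_subset_iff.mpr (hmem b hb)) ?_ (fun b hb => by simpa using hle b hb)
  intro b hb b' hb' hne
  simp only [Function.onFun, Finset.disjoint_singleton]
  exact fun h => hne (hinj hb hb' h)

-- … and of course directly by the tree's lemma:
example (Bad T : Finset β) {a : β → ℝ} (heal₀ : β → β) {q : ℝ}
    (ha : ∀ b ∈ T, 0 ≤ a b) (hq : 0 ≤ q) (hmem : ∀ b ∈ Bad, heal₀ b ∈ T)
    (hinj : Set.InjOn heal₀ ↑Bad) (hle : ∀ b ∈ Bad, a b ≤ q * a (heal₀ b)) :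
    ∑ b ∈ Bad, a b ≤ q * ∑ b ∈ T, a b :=
  sum_le_mul_sum_of_heal Bad T heal₀ ha hq hmem hinj hle

/-- **THE SET-VALUED HEALING INEQUALITY SUMMED OVER PINNED COMPONENTS** (cover + union bound, BY NAME through
`T4WeightBudget.relWeight_le_sum_of_cover`): `Σ_{Bad} a ≤ (Σ_{x ∈ X} q x)·Σ_T a`. Disjointness is asked only INSIDE
each sub-class `Badx x` (PRICING v5 F22 (c): across different pinned components the classes need not be disjoint —
the outer sum is over `x`). [folklore] -/
theorem sum_le_sum_mul_sum_of_healSets (X : Finset α) (Badx : α → Finset β) (heal : α → β → Finset β) (q : α → ℝ)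
    {Bad T : Finset β} {a : β → ℝ} (ha : ∀ b, 0 ≤ a b) (hcov : Bad ⊆ X.biUnion Badx)
    (hq : ∀ x ∈ X, 0 ≤ q x) (hmem : ∀ x ∈ X, ∀ b ∈ Badx x, heal x b ⊆ T)
    (hdisj : ∀ x ∈ X, (↑(Badx x) : Set β).PairwiseDisjoint (heal x))
    (hle : ∀ x ∈ X, ∀ b ∈ Badx x, a b ≤ q x * ∑ τ ∈ heal x b, a τ) :
    ∑ b ∈ Bad, a b ≤ (∑ x ∈ X, q x) * ∑ b ∈ T, a b :=
  relWeight_le_sum_of_cover X Badx ha hcov fun x hx =>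
    sum_le_mul_sum_of_healSet (Badx x) T (heal x) (fun b _ => ha b) (hq x hx) (hmem x hx) (hdisj x hx) (hle x hx)

end Heal

/-! ## §2 Set-valued healing laws for one run, and the END `RelWeightBound` -/

section Laws

variable {ι α α' : Type*}

/-- **SET-VALUED HEALING LAWS for ONE run** (the hypothesis SHAPE the (R-top) cut inhabits; displayed, never asserted).
As `HealingMap.HealingLaws`, except that each bad term `τ` of the sub-class `Badx K x` of a pinned old component `x` is
healed into a finite CLASS `heal K x τ ⊆ T K` of terms («same history off `C̃`, every level-`K` pass∕fail pattern on
`C̃`»), the classes are PAIRWISE DISJOINT across `Badx K x`, and the source-uniform quotient bound reads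
`A K t τ ≤ q K x · Σ_{τ' ∈ heal K x τ} A K t τ'`. [folklore] -/
structure HealingLawsSet (l₀ : ℝ) (T : ℕ → Finset ι) (A : ℕ → ℝ → ι → ℝ) (Bad : ℕ → ℝ → Finset ι)
    (X : ℕ → Finset α) (Badx : ℕ → α → Finset ι) (heal : ℕ → α → ι → Finset ι) (q : ℕ → α → ℝ) : Prop where
  /-- the bad class consists of terms -/
  bad_subset : ∀ K t, |t| ≤ l₀ → Bad K t ⊆ T K
  /-- every bad term contains some pinned old component -/
  cover : ∀ K t, |t| ≤ l₀ → ∀ τ ∈ Bad K t, ∃ x ∈ X K, τ ∈ Badx K x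
  /-- the healing class of a bad term consists of terms (healing-closedness of the index family) -/
  heal_subset : ∀ K, ∀ x ∈ X K, ∀ τ ∈ Badx K x, heal K x τ ⊆ T K
  /-- the healing classes of the bad terms of ONE pinned component are pairwise disjoint -/
  heal_disjoint : ∀ K, ∀ x ∈ X K, (↑(Badx K x) : Set ι).PairwiseDisjoint (heal K x)
  /-- the quotients are non-negative -/
  q_nonneg : ∀ K, ∀ x ∈ X K, 0 ≤ q K x
  /-- the quotient bound: a bad term weighs at most `q` times its healing CLASS, uniformly in the source -/
  le_heal : ∀ K t, |t| ≤ l₀ → ∀ x ∈ X K, ∀ τ ∈ Badx K x, A K t τ ≤ q K x * ∑ τ' ∈ heal K x τ, A K t τ'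

variable {l₀ : ℝ} {T : ℕ → Finset ι} {A B : ℕ → ℝ → ι → ℝ} {Bad : ℕ → ℝ → Finset ι}
  {X : ℕ → Finset α} {Badx : ℕ → α → Finset ι} {heal : ℕ → α → ι → Finset ι} {q : ℕ → α → ℝ}
  {X' : ℕ → Finset α'} {Badx' : ℕ → α' → Finset ι} {heal' : ℕ → α' → ι → Finset ι} {q' : ℕ → α' → ℝ}

/-- Every single-valued healing witness is a set-valued one (singleton classes). [folklore] -/
theorem HealingLawsSet.ofLaws {heal₀ : ℕ → α → ι → ι} (h : HealingLaws l₀ T A Bad X Badx heal₀ q) :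
    HealingLawsSet l₀ T A Bad X Badx (fun K x τ => {heal₀ K x τ}) q where
  bad_subset := h.bad_subset
  cover := h.cover
  heal_subset K x hx τ hτ := Finset.singleton_subset_iff.mpr (h.heal_mem K x hx τ hτ)
  heal_disjoint K x hx := by
    intro τ hτ τ' hτ' hne
    simp only [Function.onFun, Finset.disjoint_singleton]
    exact fun e => hne (h.heal_injOn K x hx hτ hτ' e)
  q_nonneg := h.q_nonneg
  le_heal K t ht x hx τ hτ := by simpa using h.le_heal K t ht x hx τ hτ

/-- **ONE RUN**: set-valued healing laws + non-negative weights ⟹ the bad class has relative weight `≤ Σ_{x ∈ X K} q K x`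
at every cutoff and every `|t| ≤ l₀`. [folklore] -/
theorem HealingLawsSet.bad_le (h : HealingLawsSet l₀ T A Bad X Badx heal q)
    (hA : ∀ K t, |t| ≤ l₀ → ∀ τ, 0 ≤ A K t τ) (K : ℕ) (t : ℝ) (ht : |t| ≤ l₀) :
    ∑ τ ∈ Bad K t, A K t τ ≤ (∑ x ∈ X K, q K x) * ∑ τ ∈ T K, A K t τ := by
  classical
  have hcov : Bad K t ⊆ (X K).biUnion (Badx K) := fun τ hτ => Finset.mem_biUnion.mpr (h.cover K t ht τ hτ)
  exact sum_le_sum_mul_sum_of_healSets (X K) (Badx K) (heal K) (q K) (hA K t ht) hcov (h.q_nonneg K)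
    (h.heal_subset K) (h.heal_disjoint K) (h.le_heal K t ht)

/-- The total of the quotients is non-negative. [folklore] -/
theorem HealingLawsSet.sum_q_nonneg (h : HealingLawsSet l₀ T A Bad X Badx heal q) (K : ℕ) :
    0 ≤ ∑ x ∈ X K, q K x :=
  Finset.sum_nonneg (h.q_nonneg K)

/-- **THE END OF ROUTE R-H UNDER THE (R-top) CUT, KERNEL HALF: two runs' SET-VALUED healing laws ⟹ NE7b's output shape
`RelWeightBound`.** Same statement as `HealingMap.relWeightBound_of_healing` with `HealingLawsSet` for both runs: common
source-free term sets and bad classes, non-negative weights, a common majorant `W` of both quotient totals from `K₀` on,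
`W K < 1` there and `Σ W < ∞` ⟹ `T4WeightBudget.RelWeightBound` with the bad classes emptied below `K₀`
(`relWeightBound_of_eventually` BY NAME). [folklore] -/
theorem relWeightBound_of_healingSet {K₀ : ℕ} {W : ℕ → ℝ}
    (hA : HealingLawsSet l₀ T A Bad X Badx heal q) (hB : HealingLawsSet l₀ T B Bad X' Badx' heal' q')
    (hA0 : ∀ K t, |t| ≤ l₀ → ∀ τ, 0 ≤ A K t τ) (hB0 : ∀ K t, |t| ≤ l₀ → ∀ τ, 0 ≤ B K t τ)
    (hWA : ∀ K, K₀ ≤ K → ∑ x ∈ X K, q K x ≤ W K) (hWB : ∀ K, K₀ ≤ K → ∑ x ∈ X' K, q' K x ≤ W K)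
    (h1 : ∀ K, K₀ ≤ K → W K < 1) (hs : Summable W) :
    RelWeightBound l₀ T A B (fun K t => if K₀ ≤ K then Bad K t else ∅) (Set.indicator {K | K₀ ≤ K} W) :=
  relWeightBound_of_eventually (fun K t ht _ => hA.bad_subset K t ht)
    (fun K hK => (hA.sum_q_nonneg K).trans (hWA K hK)) h1 hs
    (fun K t ht hK => (hA.bad_le hA0 K t ht).trans
      (mul_le_mul_of_nonneg_right (hWA K hK) (Finset.sum_nonneg fun τ _ => hA0 K t ht τ)))
    (fun K t ht hK => (hB.bad_le hB0 K t ht).trans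
      (mul_le_mul_of_nonneg_right (hWB K hK) (Finset.sum_nonneg fun τ _ => hB0 K t ht τ)))

/-- **H6-GLUE, SET-VALUED: healing laws + the two-rate majorant ⟹ `RelWeightBound` from SOME `K₀` on** (as
`HealingMap.exists_relWeightBound_of_healing_majorant`: `Σ_x q K x ≤ V·r^{K − j⋆(K)}` for both runs, `0 < r < 1`, `0 ≤ V`,
`c·K ≤ K − j⋆(K)`; `summable_weightMajorant` ∕ `eventually_weightMajorant_lt` BY NAME). [folklore] -/
theorem exists_relWeightBound_of_healingSet_majorant {r V c : ℝ} {jstar : ℕ → ℕ}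
    (hA : HealingLawsSet l₀ T A Bad X Badx heal q) (hB : HealingLawsSet l₀ T B Bad X' Badx' heal' q')
    (hA0 : ∀ K t, |t| ≤ l₀ → ∀ τ, 0 ≤ A K t τ) (hB0 : ∀ K t, |t| ≤ l₀ → ∀ τ, 0 ≤ B K t τ)
    (h0 : 0 < r) (hr1 : r < 1) (hV : 0 ≤ V) (hc : 0 < c)
    (hfrac : ∀ K : ℕ, c * K ≤ ((K - jstar K : ℕ) : ℝ))
    (hmajA : ∀ K, ∑ x ∈ X K, q K x ≤ V * r ^ (K - jstar K))
    (hmajB : ∀ K, ∑ x ∈ X' K, q' K x ≤ V * r ^ (K - jstar K)) :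
    ∃ K₀ : ℕ, RelWeightBound l₀ T A B (fun K t => if K₀ ≤ K then Bad K t else ∅)
      (Set.indicator {K | K₀ ≤ K} fun K => V * r ^ (K - jstar K)) := by
  obtain ⟨K₀, hK₀⟩ := Filter.eventually_atTop.mp
    (eventually_weightMajorant_lt h0 hr1 hV hc one_pos hfrac)
  exact ⟨K₀, relWeightBound_of_healingSet hA hB hA0 hB0 (fun K _ => hmajA K) (fun K _ => hmajB K) hK₀
    (summable_weightMajorant h0 hr1 hV hc hfrac)⟩

/-- Consistency: the single-valued END is recovered from the set-valued one through `HealingLawsSet.ofLaws`. -/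
example {heal₀ : ℕ → α → ι → ι} {heal₀' : ℕ → α' → ι → ι} {r V c : ℝ} {jstar : ℕ → ℕ}
    (hA : HealingLaws l₀ T A Bad X Badx heal₀ q) (hB : HealingLaws l₀ T B Bad X' Badx' heal₀' q')
    (hA0 : ∀ K t, |t| ≤ l₀ → ∀ τ, 0 ≤ A K t τ) (hB0 : ∀ K t, |t| ≤ l₀ → ∀ τ, 0 ≤ B K t τ)
    (h0 : 0 < r) (hr1 : r < 1) (hV : 0 ≤ V) (hc : 0 < c)
    (hfrac : ∀ K : ℕ, c * K ≤ ((K - jstar K : ℕ) : ℝ))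
    (hmajA : ∀ K, ∑ x ∈ X K, q K x ≤ V * r ^ (K - jstar K))
    (hmajB : ∀ K, ∑ x ∈ X' K, q' K x ≤ V * r ^ (K - jstar K)) :
    ∃ K₀ : ℕ, RelWeightBound l₀ T A B (fun K t => if K₀ ≤ K then Bad K t else ∅)
      (Set.indicator {K | K₀ ≤ K} fun K => V * r ^ (K - jstar K)) :=
  exists_relWeightBound_of_healingSet_majorant (HealingLawsSet.ofLaws hA) (HealingLawsSet.ofLaws hB) hA0 hB0 h0 hr1
    hV hc hfrac hmajA hmajB

end Laws

/-! ## §3 The POSITION-FIBRED count (F20b) and the END with an explicit weight -/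

section Count

variable {α π : Type*} [DecidableEq π]

/-- **COUNTING BY BIRTH SCALE, FIBRED OVER BIRTH POSITIONS** (refuter's `Scratch.sum_le_twoRate_sum_fibred`,
PRICING-NE7b v4 F20b): every pinned component `x ∈ X` has a birth scale `birth x < j⋆` and a birth POSITION `pos x`;
at most `vol·Λ^{K−j}` POSITIONS occur at birth scale `j`; and at each birth scale `j` and position `y` the quotients of
the components born there SUM to at most `σ^{K−j}` (shapes ∕ genealogies summed inside, `σ ≥ 0`). Then
`Σ_{x ∈ X} q x ≤ vol·Σ_{j < j⋆} Λ^{K−j}·σ^{K−j}` — the conclusion of `HealingMap.sum_le_twoRate_sum`, with its cardinality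
hypothesis replaced by the inhabitable position count. [folklore] -/
theorem sum_le_twoRate_sum_fibred (X : Finset α) (q : α → ℝ) (birth : α → ℕ) (pos : α → π)
    {vol Λ σ : ℝ} {jstar K : ℕ} (hσ : 0 ≤ σ) (hbirth : ∀ x ∈ X, birth x < jstar)
    (hcount : ∀ j, j < jstar → (((X.filter fun x => birth x = j).image pos).card : ℝ) ≤ vol * Λ ^ (K - j))
    (hq : ∀ j y, ∑ x ∈ (X.filter fun x => birth x = j).filter (fun x => pos x = y), q x ≤ σ ^ (K - j)) :
    ∑ x ∈ X, q x ≤ vol * ∑ j ∈ range jstar, Λ ^ (K - j) * σ ^ (K - j) := by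
  have hmaps : ∀ x ∈ X, birth x ∈ range jstar := fun x hx => mem_range.mpr (hbirth x hx)
  rw [← Finset.sum_fiberwise_of_maps_to hmaps, Finset.mul_sum]
  refine Finset.sum_le_sum fun j hj => ?_
  set S := X.filter fun x => birth x = j with hS
  have hmaps' : ∀ x ∈ S, pos x ∈ S.image pos := fun x hx => mem_image_of_mem pos hx
  calc ∑ x ∈ S, q x = ∑ y ∈ S.image pos, ∑ x ∈ S with pos x = y, q x :=
        (Finset.sum_fiberwise_of_maps_to hmaps' _).symm
    _ ≤ ∑ y ∈ S.image pos, σ ^ (K - j) := Finset.sum_le_sum fun y _ => hq j y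
    _ = ((S.image pos).card : ℝ) * σ ^ (K - j) := by rw [Finset.sum_const, nsmul_eq_mul]
    _ ≤ vol * Λ ^ (K - j) * σ ^ (K - j) :=
        mul_le_mul_of_nonneg_right (hcount j (mem_range.mp hj)) (pow_nonneg hσ _)
    _ = vol * (Λ ^ (K - j) * σ ^ (K - j)) := by ring

/-- **… HENCE THE TWO-RATE MAJORANT, FIBRED FORM** (`T4WeightBudget.twoRate_majorant_le` BY NAME): with `Λ, σ, vol ≥ 0`,
`Λσ < 1`, `j⋆ ≤ K`: `Σ_{x ∈ X} q x ≤ vol·(Λσ∕(1−Λσ))·(Λσ)^{K−j⋆}`. [folklore] -/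
theorem sum_le_twoRate_majorant_fibred (X : Finset α) (q : α → ℝ) (birth : α → ℕ) (pos : α → π)
    {vol Λ σ : ℝ} {jstar K : ℕ} (hvol : 0 ≤ vol) (hΛ : 0 ≤ Λ) (hσ : 0 ≤ σ) (hr : Λ * σ < 1) (hj : jstar ≤ K)
    (hbirth : ∀ x ∈ X, birth x < jstar)
    (hcount : ∀ j, j < jstar → (((X.filter fun x => birth x = j).image pos).card : ℝ) ≤ vol * Λ ^ (K - j))
    (hq : ∀ j y, ∑ x ∈ (X.filter fun x => birth x = j).filter (fun x => pos x = y), q x ≤ σ ^ (K - j)) :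
    ∑ x ∈ X, q x ≤ vol * (Λ * σ / (1 - Λ * σ)) * (Λ * σ) ^ (K - jstar) := by
  have h1 := sum_le_twoRate_sum_fibred X q birth pos hσ hbirth hcount hq
  have h2 := twoRate_majorant_le hvol hΛ hσ hr hj (vol := vol)
  have h3 : vol * ((Λ * σ) ^ (K - jstar + 1) / (1 - Λ * σ)) =
      vol * (Λ * σ / (1 - Λ * σ)) * (Λ * σ) ^ (K - jstar) := by
    rw [pow_succ]
    ring
  linarith

end Count

section End

variable {ι α α' π π' : Type*} [DecidableEq π] [DecidableEq π']
  {l₀ : ℝ} {T : ℕ → Finset ι} {A B : ℕ → ℝ → ι → ℝ} {Bad : ℕ → ℝ → Finset ι}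
  {X : ℕ → Finset α} {Badx : ℕ → α → Finset ι} {heal : ℕ → α → ι → Finset ι} {q : ℕ → α → ℝ}
  {X' : ℕ → Finset α'} {Badx' : ℕ → α' → Finset ι} {heal' : ℕ → α' → ι → Finset ι} {q' : ℕ → α' → ℝ}

/-- **ROUTE R-H UNDER THE (R-top) CUT, KERNEL END WITH AN EXPLICIT WEIGHT AND THE FIBRED COUNT.** Two runs' SET-VALUED
healing laws over the same term sets and bad classes; per run, every pinned old component at cutoff `K` has a birth
scale `< j⋆(K)` and a birth position, at most `vol·Λ^{K−j}` birth POSITIONS occur at scale `j`, and the quotients of the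
components born at scale `j` and position `y` SUM to `≤ σ^{K−j}`; `vol, Λ, σ ≥ 0`, `0 < Λσ < 1`; `j⋆(K) ≤ K` and
`c·K ≤ K − j⋆(K)`. THEN some `K₀` gives `T4WeightBudget.RelWeightBound` (bad classes emptied below `K₀`) with the weight
`W K = vol·(Λσ∕(1−Λσ))·(Λσ)^{K−j⋆(K)}`. All analytic content stays DISPLAYED (`hcount`, `hq`, the laws). [folklore] -/
theorem exists_relWeightBound_of_healingSet_countFibred {birth : ℕ → α → ℕ} {birth' : ℕ → α' → ℕ}
    {pos : ℕ → α → π} {pos' : ℕ → α' → π'} {jstar : ℕ → ℕ} {vol Λ σ c : ℝ}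
    (hA : HealingLawsSet l₀ T A Bad X Badx heal q) (hB : HealingLawsSet l₀ T B Bad X' Badx' heal' q')
    (hA0 : ∀ K t, |t| ≤ l₀ → ∀ τ, 0 ≤ A K t τ) (hB0 : ∀ K t, |t| ≤ l₀ → ∀ τ, 0 ≤ B K t τ)
    (hvol : 0 ≤ vol) (hΛ : 0 ≤ Λ) (hσ : 0 ≤ σ) (hr0 : 0 < Λ * σ) (hr1 : Λ * σ < 1) (hc : 0 < c)
    (hjK : ∀ K, jstar K ≤ K) (hfrac : ∀ K : ℕ, c * K ≤ ((K - jstar K : ℕ) : ℝ))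
    (hbirthA : ∀ K, ∀ x ∈ X K, birth K x < jstar K)
    (hcountA : ∀ K j, j < jstar K →
      ((((X K).filter fun x => birth K x = j).image (pos K)).card : ℝ) ≤ vol * Λ ^ (K - j))
    (hqA : ∀ K j y, ∑ x ∈ ((X K).filter fun x => birth K x = j).filter (fun x => pos K x = y), q K x ≤ σ ^ (K - j))
    (hbirthB : ∀ K, ∀ x ∈ X' K, birth' K x < jstar K)
    (hcountB : ∀ K j, j < jstar K →
      ((((X' K).filter fun x => birth' K x = j).image (pos' K)).card : ℝ) ≤ vol * Λ ^ (K - j))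
    (hqB : ∀ K j y,
      ∑ x ∈ ((X' K).filter fun x => birth' K x = j).filter (fun x => pos' K x = y), q' K x ≤ σ ^ (K - j)) :
    ∃ K₀ : ℕ, RelWeightBound l₀ T A B (fun K t => if K₀ ≤ K then Bad K t else ∅)
      (Set.indicator {K | K₀ ≤ K} fun K => vol * (Λ * σ / (1 - Λ * σ)) * (Λ * σ) ^ (K - jstar K)) :=
  exists_relWeightBound_of_healingSet_majorant hA hB hA0 hB0 hr0 hr1
    (mul_nonneg hvol (div_nonneg hr0.le (by linarith))) hc hfrac
    (fun K => sum_le_twoRate_majorant_fibred (X K) (q K) (birth K) (pos K) hvol hΛ hσ hr1 (hjK K) (hbirthA K)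
      (hcountA K) (hqA K))
    (fun K => sum_le_twoRate_majorant_fibred (X' K) (q' K) (birth' K) (pos' K) hvol hΛ hσ hr1 (hjK K) (hbirthB K)
      (hcountB K) (hqB K))

/-- The single-valued laws with the fibred count (F20b alone, without (R-top)): through `HealingLawsSet.ofLaws`. -/
theorem exists_relWeightBound_of_healing_countFibred {heal₀ : ℕ → α → ι → ι} {heal₀' : ℕ → α' → ι → ι}
    {birth : ℕ → α → ℕ} {birth' : ℕ → α' → ℕ} {pos : ℕ → α → π} {pos' : ℕ → α' → π'} {jstar : ℕ → ℕ}
    {vol Λ σ c : ℝ}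
    (hA : HealingLaws l₀ T A Bad X Badx heal₀ q) (hB : HealingLaws l₀ T B Bad X' Badx' heal₀' q')
    (hA0 : ∀ K t, |t| ≤ l₀ → ∀ τ, 0 ≤ A K t τ) (hB0 : ∀ K t, |t| ≤ l₀ → ∀ τ, 0 ≤ B K t τ)
    (hvol : 0 ≤ vol) (hΛ : 0 ≤ Λ) (hσ : 0 ≤ σ) (hr0 : 0 < Λ * σ) (hr1 : Λ * σ < 1) (hc : 0 < c)
    (hjK : ∀ K, jstar K ≤ K) (hfrac : ∀ K : ℕ, c * K ≤ ((K - jstar K : ℕ) : ℝ))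
    (hbirthA : ∀ K, ∀ x ∈ X K, birth K x < jstar K)
    (hcountA : ∀ K j, j < jstar K →
      ((((X K).filter fun x => birth K x = j).image (pos K)).card : ℝ) ≤ vol * Λ ^ (K - j))
    (hqA : ∀ K j y, ∑ x ∈ ((X K).filter fun x => birth K x = j).filter (fun x => pos K x = y), q K x ≤ σ ^ (K - j))
    (hbirthB : ∀ K, ∀ x ∈ X' K, birth' K x < jstar K)
    (hcountB : ∀ K j, j < jstar K →
      ((((X' K).filter fun x => birth' K x = j).image (pos' K)).card : ℝ) ≤ vol * Λ ^ (K - j))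
    (hqB : ∀ K j y,
      ∑ x ∈ ((X' K).filter fun x => birth' K x = j).filter (fun x => pos' K x = y), q' K x ≤ σ ^ (K - j)) :
    ∃ K₀ : ℕ, RelWeightBound l₀ T A B (fun K t => if K₀ ≤ K then Bad K t else ∅)
      (Set.indicator {K | K₀ ≤ K} fun K => vol * (Λ * σ / (1 - Λ * σ)) * (Λ * σ) ^ (K - jstar K)) :=
  exists_relWeightBound_of_healingSet_countFibred (HealingLawsSet.ofLaws hA) (HealingLawsSet.ofLaws hB) hA0 hB0 hvol
    hΛ hσ hr0 hr1 hc hjK hfrac hbirthA hcountA hqA hbirthB hcountB hqB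

end End

end Summit.QuantumFields.BalabanUV.T4Continuum.NE7b.HealingMapClass
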